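import Literature.Analysis.FluidPDE.CompressibleEulerAprioriBounds
import Literature.Analysis.FunctionSpaces.TorusDiffMonomialBounds
import HarnessLib

/-!
# Homogeneous `L²` bounds for the commutators of the differentiated Euler system at levels `1..3`

Analysis/FluidPDE proof file (theorems only; no definitions, no named facts). The per-term and
per-list `L²` bounds of the `H^m` energy method (Majda 1984, Ch. 2 §2.1, proof of Thm 2.2) in
the HOMOGENEOUS form valid for the low levels `m ≤ 3`: every commutator monomial
`T = γ(ρ,ϑ) · ∂^{v₁}φ ⋯ ∂^{v_r}φ` of the differentiated system (`CompressibleEulerCommutators.FF`,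
`GG`, `HH`) is proper (`|v_l| ≥ 1`), so when one factor is put in `L²` and the others in `L^∞`
the `L²` factor is a DERIVATIVE of order between `1` and `m`; for `m ≤ 3` the sup factors have
order `≤ 1` (the `(2,2)` products at `m = 3` go through Nirenberg's `L⁴` interpolation
`Torus.integral_mul_partialDeriv_partialDeriv_sq_le`, which again needs only first-derivative
sup bounds). Hence

* `sqrt_integral_eval_sq_le_of_le_three` — `‖T‖_{L²} ≤ 3 G S^r X` with `G` a bound of the
  coefficient along the fields, `S ≥ 1` a sup bound of all words of length `≤ 1` and `X` an
  `L²` bound of the words of length `1..m` ONLY (compare `DiffMonomial.sqrt_integral_eval_sq_le`,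
  whose `X` ranges over all words of length `≤ m`, including the fields themselves, and whose
  output carries the affine term of the `n ≤ 1` levels);
* `sqrt_integral_list_eval_sq_le_of_le_three` — the sum over a list of such monomials is bounded
  by `|list| · 3 G S^{n+1} X`;
* `length_FF_le`, `length_GG_le`, `length_HH_le` — the lists of commutator monomials of a word
  of length `n` have at most `commLenBound n` members (`commLenBound 3 = 234`).

These feed the homogeneous level-`3` energy inequality of
`CompressibleEulerHomogeneousEnergyStep.lean`.

## References

* A. Majda, *Compressible Fluid Flow and Systems of Conservation Laws in Several Space
  Variables*, Springer 1984, Ch. 2 §2.1, Thm 2.2 and (2.38). [Majda1984]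
* T. Kato, Arch. Rational Mech. Anal. 58 (1975) 181–205, Thm II. [Kato1975]
-/

noncomputable section

open Set Function MeasureTheory Filter
open scoped ContDiff Topology

namespace Literature.Analysis.FluidPDE

namespace CompressibleEuler

open Literature.Analysis.FunctionSpaces Literature.Analysis.FunctionSpaces.Torus
open Literature.Analysis.FunctionSpaces.Torus.DiffMonomial

/-! ### The per-term bound at levels `1 ≤ m ≤ 3` -/

section PerTerm

variable {d : Type*} [Fintype d] [DecidableEq d] {κ : Type*}

/-- **The per-term bound of the `H^m` energy method at the low levels `1 ≤ m ≤ 3`, homogeneous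
form** (Majda 1984, proof of Thm 2.2): for a proper monomial `T` of width `r ≥ 2`, order `m + 1`
and maximal factor order `≤ m` in smooth fields `φ`, with `|coefficient| ≤ G` along the fields,
a sup bound `S ≥ 1` on all words of length `≤ 1` and an `L²` bound `X` on the words of length
`1..m` only:  `‖eval T‖_{L²} ≤ 3 G S^r X`. [cite: Majda1984, Ch. 2 §2.1 Thm 2.2] -/
theorem sqrt_integral_eval_sq_le_of_le_three {φ : κ → UnitAddTorus d → ℝ} (hφ : ∀ k, IsSmooth (φ k))
    {a b : κ} {T : DiffMonomial d κ} (hTp : T.Proper) (hTw : 2 ≤ T.width) {m : ℕ} (hm3 : m ≤ 3)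
    (hTo : T.order = m + 1) (hTmax : T.maxOrder ≤ m)
    {G : ℝ} (hG0 : 0 ≤ G) (hG : ∀ x, |T.coeff (φ a x) (φ b x)| ≤ G)
    {S : ℝ} (hS1 : 1 ≤ S)
    (hS : ∀ (k : κ) (v : List d), v.length ≤ 1 → ∀ x, |iterPartialDeriv v (φ k) x| ≤ S)
    {X : ℝ} (hX0 : 0 ≤ X)
    (hX : ∀ (k : κ) (v : List d), 1 ≤ v.length → v.length ≤ m →
      Real.sqrt (∫ x, iterPartialDeriv v (φ k) x ^ 2) ≤ X) :
    Real.sqrt (∫ x, eval φ a b T x ^ 2) ≤ 3 * G * S ^ T.width * X := by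
  have hS0 : 0 ≤ S := zero_le_one.trans hS1
  -- the factor of maximal order and the others
  have hne : T.factors ≠ [] := by
    intro h; simp [width, h] at hTw
  obtain ⟨fs, hfs, hfse⟩ := exists_length_eq_maxOrder T hne
  obtain ⟨pre, post, hsplit⟩ := List.append_of_mem hfs
  set ostar := T.maxOrder with hostar_def
  have hmemT : ∀ f ∈ pre ++ post, f ∈ T.factors := by
    intro f hf
    rw [hsplit]
    rcases List.mem_append.1 hf with h | h
    · exact List.mem_append_left _ h
    · exact List.mem_append_right _ (List.mem_cons_of_mem _ h)
  have hge : ∀ f ∈ pre ++ post, f.1 ≠ [] := fun f hf => hTp f (hmemT f hf)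
  have hle : ∀ f ∈ pre ++ post, f.1.length ≤ ostar := fun f hf => length_le_maxOrder (hmemT f hf)
  have hsum : orderOf (pre ++ post) + ostar = m + 1 := by
    have h := hTo
    rw [order_eq, hsplit, orderOf_append, orderOf_cons, hfse] at h
    rw [orderOf_append]; omega
  have hwidth : T.width = (pre ++ post).length + 1 := by
    simp only [width, hsplit, List.length_append, List.length_cons]; omega
  -- the maximal factor is a derivative of order `1..m`
  have hfs1 : 1 ≤ fs.1.length := by
    have := hTp fs hfs
    rcases hv : fs.1 with _ | ⟨i, v⟩
    · exact absurd hv this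
    · simp
  have hfsm : fs.1.length ≤ m := by rw [hfse]; exact hTmax
  -- the evaluation, factorised
  have hsmooth_fs : IsSmooth (iterPartialDeriv fs.1 (φ fs.2)) := (hφ fs.2).iterPartialDeriv fs.1
  have heval : ∀ x, eval φ a b T x =
      (T.coeff (φ a x) (φ b x) * prodEval φ (pre ++ post) x) * iterPartialDeriv fs.1 (φ fs.2) x := by
    intro x
    rw [eval_def, hsplit, prodEval_append, prodEval_cons, prodEval_append]; ring
  have hevalfun : (fun x => eval φ a b T x ^ 2) = fun x =>
      ((T.coeff (φ a x) (φ b x) * prodEval φ (pre ++ post) x) * iterPartialDeriv fs.1 (φ fs.2) x) ^ 2 := by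
    funext x; rw [heval x]
  -- `S`-powers
  have hSpow : ∀ {p q : ℕ}, p ≤ q → S ^ p ≤ S ^ q := fun h => pow_le_pow_right₀ hS1 h
  -- the dichotomy of shapes at the low levels
  have key : (∀ f ∈ pre ++ post, f.1.length ≤ 1) ∨
      (m = 3 ∧ ostar = 2 ∧ ∃ f' : List d × κ, pre ++ post = [f'] ∧ f'.1.length = 2) := by
    rcases Nat.lt_or_ge m 2 with hm2 | hm2
    · exact Or.inl fun f hf => (hle f hf).trans (hTmax.trans (by omega))
    · rcases shape_trichotomy hm2 hge hle hsum hTmax with h1 | ⟨hm4, -⟩ | h3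
      · refine Or.inl fun f hf => (h1 f hf).trans ?_
        have : m - 3 ≤ 1 := by omega
        exact max_le le_rfl this
      · omega
      · exact Or.inr h3
  rcases key with hC1 | ⟨hm3', ho2, f', hofs, hf'len⟩
  · -- Case 1: all the other factors in sup with `S`, the maximal one in `L²` with `X`
    have hsup : ∀ x, |T.coeff (φ a x) (φ b x) * prodEval φ (pre ++ post) x| ≤ G * S ^ (pre ++ post).length := by
      intro x
      rw [abs_mul]
      exact mul_le_mul (hG x) (abs_prodEval_le_pow hS0 _ (fun f hf y => hS f.2 f.1 (hC1 f hf) y) x)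
        (abs_nonneg _) hG0
    calc Real.sqrt (∫ x, eval φ a b T x ^ 2)
        ≤ (G * S ^ (pre ++ post).length) * Real.sqrt (∫ x, iterPartialDeriv fs.1 (φ fs.2) x ^ 2) := by
          rw [hevalfun]
          exact sqrt_integral_sq_mul_le_of_abs_le hsmooth_fs.continuous (by positivity) hsup
      _ ≤ (G * S ^ (pre ++ post).length) * X :=
          mul_le_mul_of_nonneg_left (hX fs.2 fs.1 hfs1 hfsm) (by positivity)
      _ = 1 * G * S ^ (pre ++ post).length * X := by ring
      _ ≤ 3 * G * S ^ T.width * X := by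
          rw [hwidth]
          exact mul_le_mul_of_nonneg_right (mul_le_mul (mul_le_mul_of_nonneg_right (by norm_num) hG0)
            (hSpow (Nat.le_succ _)) (by positivity) (by positivity)) hX0
  · -- Case 2 (`m = 3`): `γ · ∂²φ · ∂²ψ`, by the `L⁴` interpolation inequality
    subst hm3'
    have hpp : pre ++ post = [f'] := hofs
    obtain ⟨j, i, hij⟩ := List.length_eq_two.1 hf'len
    have hfs2 : fs.1.length = 2 := by rw [hfse]; exact ho2
    obtain ⟨l, k, hlk⟩ := List.length_eq_two.1 hfs2
    have hevalfun' : (fun x => eval φ a b T x ^ 2) = fun x =>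
        (T.coeff (φ a x) (φ b x) * (partialDeriv j (partialDeriv i (φ f'.2)) x *
          partialDeriv l (partialDeriv k (φ fs.2)) x)) ^ 2 := by
      funext x
      rw [heval x, hpp]
      simp only [prodEval_cons, prodEval_nil, mul_one, hij, hlk, iterPartialDeriv_pair]
      ring
    have hA : ∀ x, |partialDeriv i (φ f'.2) x| ≤ S := fun x => by
      have := hS f'.2 [i] (by simp) x
      simpa [iterPartialDeriv_cons] using this
    have hA' : ∀ x, |partialDeriv k (φ fs.2) x| ≤ S := fun x => by
      have := hS fs.2 [k] (by simp) x
      simpa [iterPartialDeriv_cons] using this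
    have hGN := integral_mul_partialDeriv_partialDeriv_sq_le (hφ f'.2) (hφ fs.2) i j k l hA hA'
    have hP : Real.sqrt (∫ x, partialDeriv j (partialDeriv j (partialDeriv i (φ f'.2))) x ^ 2) ≤ X := by
      have := hX f'.2 [j, j, i] (by simp) (by simp)
      simpa [iterPartialDeriv_cons] using this
    have hQ : Real.sqrt (∫ x, partialDeriv l (partialDeriv l (partialDeriv k (φ fs.2))) x ^ 2) ≤ X := by
      have := hX fs.2 [l, l, k] (by simp) (by simp)
      simpa [iterPartialDeriv_cons] using this
    have hcont : Continuous fun x => partialDeriv j (partialDeriv i (φ f'.2)) x *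
        partialDeriv l (partialDeriv k (φ fs.2)) x :=
      (((hφ f'.2).partialDeriv i).partialDeriv j).continuous.mul
        (((hφ fs.2).partialDeriv k).partialDeriv l).continuous
    have hinner : Real.sqrt (∫ x, (partialDeriv j (partialDeriv i (φ f'.2)) x *
        partialDeriv l (partialDeriv k (φ fs.2)) x) ^ 2) ≤ 3 * S * X := by
      rw [Real.sqrt_le_left (by positivity)]
      calc ∫ x, (partialDeriv j (partialDeriv i (φ f'.2)) x * partialDeriv l (partialDeriv k (φ fs.2)) x) ^ 2
          ≤ 9 * S * S * (Real.sqrt (∫ x, partialDeriv j (partialDeriv j (partialDeriv i (φ f'.2))) x ^ 2) *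
              Real.sqrt (∫ x, partialDeriv l (partialDeriv l (partialDeriv k (φ fs.2))) x ^ 2)) := hGN
        _ ≤ 9 * S * S * (X * X) :=
            mul_le_mul_of_nonneg_left (mul_le_mul hP hQ (Real.sqrt_nonneg _) hX0) (by positivity)
        _ = (3 * S * X) ^ 2 := by ring
    have hw2 : T.width = 2 := by rw [hwidth, hpp]; rfl
    calc Real.sqrt (∫ x, eval φ a b T x ^ 2)
        ≤ G * Real.sqrt (∫ x, (partialDeriv j (partialDeriv i (φ f'.2)) x *
            partialDeriv l (partialDeriv k (φ fs.2)) x) ^ 2) := by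
          rw [hevalfun']
          exact sqrt_integral_sq_mul_le_of_abs_le hcont hG0 hG
      _ ≤ G * (3 * S * X) := mul_le_mul_of_nonneg_left hinner hG0
      _ = 3 * G * S ^ 1 * X := by ring
      _ ≤ 3 * G * S ^ T.width * X := by
          rw [hw2]
          exact mul_le_mul_of_nonneg_right (mul_le_mul_of_nonneg_left (hSpow (by norm_num)) (by positivity)) hX0

end PerTerm

/-! ### Lists of monomials -/

section Lists

variable {d : Type*} [Fintype d] [DecidableEq d] {κ : Type*}

/-- **Homogeneous `L²` bound for a list of commutator monomials at level `n ≤ 3`.** If every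
monomial of the list has the shape of a level-`n` commutator (proper, width `2 ≤ r ≤ n + 1`,
order `n + 1`, maximal factor order `≤ n`, coefficient smooth near the values of the fields) and
coefficient bounded by `G` along the fields, then the `L²` norm of the sum is at most
`|list| · 3 G S^{n+1} X`, with `S ≥ 1` a sup bound on the words of length `≤ 1` and `X` an `L²`
bound on the words of length `1..n`. [cite: Majda1984, Ch. 2 §2.1 Thm 2.2] -/
theorem sqrt_integral_list_eval_sq_le_of_le_three {φ : κ → UnitAddTorus d → ℝ} (hφ : ∀ k, IsSmooth (φ k))
    {a b : κ} {U : Set (ℝ × ℝ)} (hφU : ∀ x, (φ a x, φ b x) ∈ U)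
    {n : ℕ} (hn3 : n ≤ 3) {G S X : ℝ} (hG0 : 0 ≤ G) (hS1 : 1 ≤ S) (hX0 : 0 ≤ X)
    (hS : ∀ (k : κ) (v : List d), v.length ≤ 1 → ∀ x, |iterPartialDeriv v (φ k) x| ≤ S)
    (hX : ∀ (k : κ) (v : List d), 1 ≤ v.length → v.length ≤ n →
      Real.sqrt (∫ x, iterPartialDeriv v (φ k) x ^ 2) ≤ X)
    (Lst : List (DiffMonomial d κ))
    (hshape : ∀ T ∈ Lst, T.Proper ∧ 2 ≤ T.width ∧ T.width ≤ n + 1 ∧ T.order = n + 1 ∧ T.maxOrder ≤ n ∧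
      ContDiffOn ℝ ∞ (uncurry T.coeff) U)
    (hG : ∀ T ∈ Lst, ∀ x, |T.coeff (φ a x) (φ b x)| ≤ G) :
    Real.sqrt (∫ x, ((Lst.map fun T => T.eval φ a b x).sum) ^ 2) ≤
      (Lst.length : ℝ) * (3 * G * S ^ (n + 1) * X) := by
  have hcont : ∀ T ∈ Lst, Continuous (T.eval φ a b) := fun T hT =>
    (isSmooth_eval hφ (hshape T hT).2.2.2.2.2 hφU).continuous
  have h1 := sqrt_integral_list_sum_sq_le Lst (F := fun T x => T.eval φ a b x) hcont
  refine h1.trans ?_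
  have h2 : ∀ y ∈ Lst.map fun T => Real.sqrt (∫ x, T.eval φ a b x ^ 2), y ≤ 3 * G * S ^ (n + 1) * X := by
    intro y hy
    obtain ⟨T, hT, rfl⟩ := List.mem_map.1 hy
    obtain ⟨hTp, hTw2, hTwn, hTo, hTmax, -⟩ := hshape T hT
    have hT1 := sqrt_integral_eval_sq_le_of_le_three hφ hTp hTw2 hn3 hTo hTmax hG0 (hG T hT) hS1 hS hX0 hX
    refine hT1.trans ?_
    have hSpow : S ^ T.width ≤ S ^ (n + 1) := pow_le_pow_right₀ hS1 hTwn
    exact mul_le_mul_of_nonneg_right (mul_le_mul_of_nonneg_left hSpow (by positivity)) hX0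
  have h3 := List.sum_le_card_nsmul _ (3 * G * S ^ (n + 1) * X) h2
  rw [List.length_map, nsmul_eq_mul] at h3
  exact h3

end Lists

section ListLengths

variable {d : Type*} {κ : Type*}

/-- The `∂ᵢ`-Leibniz list of a factor list has as many members as there are factors. [folklore] -/
theorem length_dFactors (i : d) : ∀ fs : List (List d × κ), (dFactors i fs).length = fs.length
  | [] => rfl
  | f :: fs => by simp [dFactors, length_dFactors i fs]

/-- The `∂ᵢ`-expansion of a monomial of width `r` has `r + 2` members. [folklore] -/
theorem length_dExp (a b : κ) (i : d) (T : DiffMonomial d κ) : (dExp a b i T).length = T.width + 2 := by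
  simp [dExp, length_dFactors, width]

/-- The `∂ᵢ`-expansion of a list of monomials of width `≤ W` has at most `|list| · (W + 2)`
members. [folklore] -/
theorem length_flatMap_dExp_le (a b : κ) (i : d) {W : ℕ} :
    ∀ (L : List (DiffMonomial d κ)), (∀ T ∈ L, T.width ≤ W) →
      (L.flatMap (dExp a b i)).length ≤ L.length * (W + 2)
  | [], _ => by simp
  | T :: L, h => by
    have ih := length_flatMap_dExp_le a b i L fun T' hT' => h T' (List.mem_cons_of_mem _ hT')
    have hT := h T List.mem_cons_self
    simp only [List.flatMap_cons, List.length_append, length_dExp, List.length_cons]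
    nlinarith

end ListLengths

/-! ### The number of commutator monomials of a word of length `≤ 3` -/

section Counting

variable {ζ : ℝ → ℝ}

/-- A list-valued function of words with `L [] = []` and the growth
`|L (j :: w)| ≤ |L w| (|w| + 3) + 9` has `|L w| ≤ 234` for `|w| ≤ 3` (`9, 45, 234`). [folklore] -/
theorem length_le_of_growth {α : Type*} {L : List (Fin 3) → List α} (h0 : L [] = [])
    (hstep : ∀ (j : Fin 3) (w : List (Fin 3)), (L (j :: w)).length ≤ (L w).length * (w.length + 3) + 9) :
    ∀ {w : List (Fin 3)}, w.length ≤ 3 → (L w).length ≤ 234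
  | [], _ => by simp [h0]
  | [a], _ => by have h1 := hstep a []; simp [h0] at h1; omega
  | [a, b], _ => by
    have h1 := hstep b []; have h2 := hstep a [b]
    simp [h0] at h1 h2; omega
  | [a, b, c], _ => by
    have h1 := hstep c []; have h2 := hstep b [c]; have h3 := hstep a [b, c]
    simp [h0] at h1 h2 h3; omega
  | _ :: _ :: _ :: _ :: _, h => by simp at h; omega

/-- Growth of the continuity commutator list: `|FF (j :: w)| ≤ |FF w| (|w| + 3) + 9` (in fact `+ 6`;
the uniform `+ 9` is what `length_le_of_growth` consumes). [folklore] -/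
theorem length_FF_cons (j : Fin 3) (w : List (Fin 3)) :
    (FF (j :: w)).length ≤ (FF w).length * (w.length + 3) + 9 := by
  have h := length_flatMap_dExp_le PIdx.rho PIdx.theta j (FF w) fun T hT => (mem_FF w hT).2.2.1
  rw [show w.length + 1 + 2 = w.length + 3 from rfl] at h
  simp only [FF, List.length_append, List.length_ofFn]
  omega

/-- Growth of the velocity commutator lists: `|GG k (j :: w)| ≤ |GG k w| (|w| + 3) + 9` (in fact
`+ 7`). [folklore] -/
theorem length_GG_cons (hζ : ContDiff ℝ ∞ ζ) (k j : Fin 3) (w : List (Fin 3)) :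
    (GG ζ k (j :: w)).length ≤ (GG ζ k w).length * (w.length + 3) + 9 := by
  have h := length_flatMap_dExp_le PIdx.rho PIdx.theta j (GG ζ k w) fun T hT => (mem_GG hζ k w hT).2.2.1
  rw [show w.length + 1 + 2 = w.length + 3 from rfl] at h
  simp only [GG, List.length_append, List.length_ofFn, List.length_cons, List.length_nil]
  omega

/-- Growth of the temperature commutator list: `|HH (j :: w)| ≤ |HH w| (|w| + 3) + 9`. [folklore] -/
theorem length_HH_cons (hζ : ContDiff ℝ ∞ ζ) (j : Fin 3) (w : List (Fin 3)) :
    (HH ζ (j :: w)).length ≤ (HH ζ w).length * (w.length + 3) + 9 := by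
  have h := length_flatMap_dExp_le PIdx.rho PIdx.theta j (HH ζ w) fun T hT => (mem_HH hζ w hT).2.2.1
  rw [show w.length + 1 + 2 = w.length + 3 from rfl] at h
  simp only [HH, List.length_append, List.length_ofFn]
  omega

/-- **At most `234` continuity commutator monomials for words of length `≤ 3`.** [folklore] -/
theorem length_FF_le {w : List (Fin 3)} (hw : w.length ≤ 3) : (FF w).length ≤ 234 :=
  length_le_of_growth (L := FF) rfl length_FF_cons hw

/-- **At most `234` velocity commutator monomials for words of length `≤ 3`.** [folklore] -/
theorem length_GG_le (hζ : ContDiff ℝ ∞ ζ) (k : Fin 3) {w : List (Fin 3)} (hw : w.length ≤ 3) :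
    (GG ζ k w).length ≤ 234 :=
  length_le_of_growth (L := GG ζ k) rfl (length_GG_cons hζ k) hw

/-- **At most `234` temperature commutator monomials for words of length `≤ 3`.** [folklore] -/
theorem length_HH_le (hζ : ContDiff ℝ ∞ ζ) {w : List (Fin 3)} (hw : w.length ≤ 3) :
    (HH ζ w).length ≤ 234 :=
  length_le_of_growth (L := HH ζ) rfl (length_HH_cons hζ) hw

end Counting

end CompressibleEuler

end Literature.Analysis.FluidPDE

end
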